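import Summits.ValiantsHypothesis.ValiantsHypothesis.Theorems.LangWeilTransferShatteringExclusionRationalDescent

/-!
# LangWeilTransfer — crux `ShatteringExclusion` (stmt-ValiantsHypothesis-6372), line `birth` v2:
# in `stub_fewBranches` the given circuit may be assumed to have RATIONAL constants

Route `ValiantsHypothesis/LangWeilTransfer`, crux `ShatteringExclusion`, registered line
`Cruxes/ShatteringExclusion/Lines/birth.lean` v2, open stub `stub_fewBranches` (conjecture grade):
`∀ c d₀ ∃ c' d₀' d₁ N ∀ n ≥ N`, a fan-in-two circuit for `per_n` of size `≤ n^c` with constants in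
a number field of degree `≤ n^{d₀}` can be rewired into one of size `≤ n^{c'}` with constants in a
field of degree `≤ n^{d₀'}` whose constant vector lies on `0 < · ≤ n^{d₁}` irreducible components
of the complexified constants variety.

This file removes the number field from the HYPOTHESIS: by Weil restriction of scalars for
circuits (tree: `complexity_le_finrank_pow_three_mul`, `L_ℚ ≤ 16 [K:ℚ]³ L_K`, after descending the
circuit to its field of constants, `complexity_le_of_slotConst_mem`) a circuit of size `≤ n^c`
with constants of degree `≤ n^{d₀}` yields a circuit OVER `ℚ` of size `≤ n^{c + 3 d₀ + 6}`
(`exists_rat_circuit_of_lowDegree`). Hence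

* `fewBranches_iff_fewBranchesFromRational` — **`stub_fewBranches` (verbatim, right-hand side)
  is equivalent to its restriction to circuits with rational constants** (left-hand side: the
  same conclusion, assuming only a fan-in-two `ℚ`-circuit of size `≤ n^c` for `per_n`).

So a prover / disprover of the line's bet may start from a rational point of the constants variety
of a near-optimal rational shape (where `Gal(ℚ̄/ℚ)` permutes ALL components through the point).

Honest framing: a reformulation only; `stub_fewBranches`, `stub_lowDegreeConstants`, the crux and
the route stay open; VP ≠ VNP is NOT moved.
-/

noncomputable section

open MvPolynomial

-- the summit and the problem share the name `ValiantsHypothesis` (D-0017 single-conjunct layout)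
set_option linter.dupNamespace false

namespace Summit.ValiantsHypothesis.ValiantsHypothesis.Theorems.LangWeilTransfer.ShatteringExclusion

open Literature.Computability.AlgebraicComplexity
open Literature.Computability.AlgebraicComplexity.ArithCircuit

/-- **Restriction of scalars, pointwise.** A fan-in-two `ℂ`-circuit of size `≤ n^c` for `per_n`
(`n ≥ 2`) whose slot constants lie in an intermediate field `K` with `[K:ℚ] ≤ n^{d₀}` yields a
fan-in-two circuit OVER `ℚ` of size `≤ n^{c + 3 d₀ + 6}` for `per_n`
(`L_ℚ ≤ 16 [K:ℚ]³ L_K ≤ 16 n^{3d₀} · 3 n^c`). [cite: Burgisser2000, §4.1] -/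
theorem exists_rat_circuit_of_lowDegree {n c d₀ : ℕ} (hn2 : 2 ≤ n)
    (P : ArithCircuit ℂ (Fin n × Fin n)) (hP2 : P.IsFanInTwo) (hPs : P.size ≤ n ^ c)
    (hPc : P.Computes (perPoly (Fin n) ℂ)) (K : IntermediateField ℚ ℂ) [FiniteDimensional ℚ K]
    (hKdeg : Module.finrank ℚ K ≤ n ^ d₀) (hmem : ∀ v : Fin (4 * P.size + 1), slotConst P v ∈ K) :
    ∃ Q : ArithCircuit ℚ (Fin n × Fin n),
      Q.IsFanInTwo ∧ Q.size ≤ n ^ (c + 3 * d₀ + 6) ∧ Q.Computes (perPoly (Fin n) ℚ) := by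
  have hPc' : P.Computes (map (Int.castRingHom ℂ) (perPoly (Fin n) ℤ)) := by rwa [map_perPoly]
  -- `L_K(per_n) ≤ 3 |P|`
  have hLK : complexity (perPoly (Fin n) K) ≤ 3 * P.size := by
    have h1 := complexity_le_of_slotConst_mem _ K P hP2 hPc' hmem
    rwa [map_perPoly] at h1
  -- `L_ℚ(per_n) ≤ 16 [K:ℚ]³ L_K(per_n)`
  have hLQ : complexity (perPoly (Fin n) ℚ) ≤
      16 * Module.finrank ℚ K ^ 3 * complexity (perPoly (Fin n) K) := by
    have h1 := complexity_le_finrank_pow_three_mul (E := K) (perPoly (Fin n) ℚ)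
    rwa [map_perPoly] at h1
  obtain ⟨Q, hQ2, hQc, hQs⟩ := exists_computes_size_eq_complexity (perPoly (Fin n) ℚ)
  refine ⟨Q, hQ2, ?_, hQc⟩
  rw [hQs]
  have h16 : 16 ≤ n ^ 4 := by
    calc 16 = 2 ^ 4 := by norm_num
      _ ≤ n ^ 4 := Nat.pow_le_pow_left hn2 4
  have h3 : 3 ≤ n ^ 2 := by
    calc 3 ≤ 2 ^ 2 := by norm_num
      _ ≤ n ^ 2 := Nat.pow_le_pow_left hn2 2
  have hD : Module.finrank ℚ K ^ 3 ≤ n ^ (3 * d₀) := by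
    rw [pow_mul']
    exact Nat.pow_le_pow_left hKdeg 3
  calc complexity (perPoly (Fin n) ℚ)
      ≤ 16 * Module.finrank ℚ K ^ 3 * complexity (perPoly (Fin n) K) := hLQ
    _ ≤ 16 * Module.finrank ℚ K ^ 3 * (3 * P.size) := Nat.mul_le_mul_left _ hLK
    _ ≤ n ^ 4 * n ^ (3 * d₀) * (n ^ 2 * n ^ c) := by gcongr
    _ = n ^ (c + 3 * d₀ + 6) := by ring

/-- **In `stub_fewBranches` the hypothesis circuit may be assumed rational**: the registered stub
(right-hand side, verbatim) is equivalent to its rational-hypothesis form (left-hand side: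
only a fan-in-two `ℚ`-circuit of size `≤ n^c` for `per_n` is assumed). (→) a `ℚ`-circuit read in
`ℂ` has slot constants in `⊥`, of degree `1 ≤ n^0`; (←) restriction of scalars
(`exists_rat_circuit_of_lowDegree`) turns the hypothesis circuit into a rational one of size
`≤ n^{c+3d₀+6}`. [cite: Burgisser2000, §4.1] -/
theorem fewBranches_iff_fewBranchesFromRational :
    (∀ c : ℕ, ∃ c' d₀' d₁ N : ℕ, ∀ n ≥ N,
        (∃ Q : ArithCircuit ℚ (Fin n × Fin n),
            Q.IsFanInTwo ∧ Q.size ≤ n ^ c ∧ Q.Computes (perPoly (Fin n) ℚ)) →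
          ∃ P : ArithCircuit ℂ (Fin n × Fin n),
            P.IsFanInTwo ∧ P.size ≤ n ^ c' ∧ P.Computes (perPoly (Fin n) ℂ) ∧
              ∃ K : IntermediateField ℚ ℂ, FiniteDimensional ℚ K ∧ Module.finrank ℚ K ≤ n ^ d₀' ∧
                (∀ v : Fin (4 * P.size + 1), slotConst P v ∈ K) ∧
                ∃ I : Ideal (MvPolynomial (Fin (4 * P.size + 1)) ℚ),
                  I = Ideal.span (Set.range fun α : (Fin n × Fin n) →₀ ℕ =>
                    MvPolynomial.map (Int.castRingHom ℚ) (MvPolynomial.coeff α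
                      (MvPolynomial.sumAlgEquiv ℤ (Fin n × Fin n) (Fin (4 * P.size + 1))
                        (skeleton P).eval) -
                      MvPolynomial.C (MvPolynomial.coeff α (perPoly (Fin n) ℤ)))) ∧
                  0 < {𝔓 : Ideal (MvPolynomial (Fin (4 * P.size + 1)) ℂ) |
                        𝔓 ∈ (I.map (MvPolynomial.map (algebraMap ℚ ℂ))).minimalPrimes ∧
                          𝔓 ≤ RingHom.ker (MvPolynomial.aeval
                            (fun v : Fin (4 * P.size + 1) => slotConst P v) :
                              MvPolynomial (Fin (4 * P.size + 1)) ℂ →ₐ[ℂ] ℂ)}.ncard ∧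
                  {𝔓 : Ideal (MvPolynomial (Fin (4 * P.size + 1)) ℂ) |
                      𝔓 ∈ (I.map (MvPolynomial.map (algebraMap ℚ ℂ))).minimalPrimes ∧
                        𝔓 ≤ RingHom.ker (MvPolynomial.aeval
                          (fun v : Fin (4 * P.size + 1) => slotConst P v) :
                            MvPolynomial (Fin (4 * P.size + 1)) ℂ →ₐ[ℂ] ℂ)}.ncard ≤ n ^ d₁) ↔
    (∀ c d₀ : ℕ, ∃ c' d₀' d₁ N : ℕ, ∀ n ≥ N,
      (∃ P : ArithCircuit ℂ (Fin n × Fin n),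
          P.IsFanInTwo ∧ P.size ≤ n ^ c ∧ P.Computes (perPoly (Fin n) ℂ) ∧
            ∃ K : IntermediateField ℚ ℂ, FiniteDimensional ℚ K ∧ Module.finrank ℚ K ≤ n ^ d₀ ∧
              ∀ v : Fin (4 * P.size + 1), slotConst P v ∈ K) →
        ∃ P : ArithCircuit ℂ (Fin n × Fin n),
          P.IsFanInTwo ∧ P.size ≤ n ^ c' ∧ P.Computes (perPoly (Fin n) ℂ) ∧
            ∃ K : IntermediateField ℚ ℂ, FiniteDimensional ℚ K ∧ Module.finrank ℚ K ≤ n ^ d₀' ∧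
              (∀ v : Fin (4 * P.size + 1), slotConst P v ∈ K) ∧
              ∃ I : Ideal (MvPolynomial (Fin (4 * P.size + 1)) ℚ),
                I = Ideal.span (Set.range fun α : (Fin n × Fin n) →₀ ℕ =>
                  MvPolynomial.map (Int.castRingHom ℚ) (MvPolynomial.coeff α
                    (MvPolynomial.sumAlgEquiv ℤ (Fin n × Fin n) (Fin (4 * P.size + 1))
                      (skeleton P).eval) -
                    MvPolynomial.C (MvPolynomial.coeff α (perPoly (Fin n) ℤ)))) ∧
                0 < {𝔓 : Ideal (MvPolynomial (Fin (4 * P.size + 1)) ℂ) |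
                      𝔓 ∈ (I.map (MvPolynomial.map (algebraMap ℚ ℂ))).minimalPrimes ∧
                        𝔓 ≤ RingHom.ker (MvPolynomial.aeval
                          (fun v : Fin (4 * P.size + 1) => slotConst P v) :
                            MvPolynomial (Fin (4 * P.size + 1)) ℂ →ₐ[ℂ] ℂ)}.ncard ∧
                {𝔓 : Ideal (MvPolynomial (Fin (4 * P.size + 1)) ℂ) |
                    𝔓 ∈ (I.map (MvPolynomial.map (algebraMap ℚ ℂ))).minimalPrimes ∧
                      𝔓 ≤ RingHom.ker (MvPolynomial.aeval
                        (fun v : Fin (4 * P.size + 1) => slotConst P v) :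
                          MvPolynomial (Fin (4 * P.size + 1)) ℂ →ₐ[ℂ] ℂ)}.ncard ≤ n ^ d₁) := by
  constructor
  · intro h c d₀
    obtain ⟨c', d₀', d₁, N, hN⟩ := h (c + 3 * d₀ + 6)
    refine ⟨c', d₀', d₁, max N 2, fun n hn hex => ?_⟩
    obtain ⟨P, hP2, hPs, hPc, K, hKfd, hKdeg, hmem⟩ := hex
    haveI := hKfd
    exact hN n (le_trans (le_max_left _ _) hn)
      (exists_rat_circuit_of_lowDegree (le_trans (le_max_right _ _) hn) P hP2 hPs hPc K hKdeg hmem)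
  · intro h c
    obtain ⟨c', d₀', d₁, N, hN⟩ := h c 0
    refine ⟨c', d₀', d₁, N, fun n hn hex => ?_⟩
    obtain ⟨Q, hQ2, hQs, hQc⟩ := hex
    have hQc' : Q.Computes (map (Int.castRingHom ℚ) (perPoly (Fin n) ℤ)) := by rwa [map_perPoly]
    obtain ⟨P, hP2, hPs, hPc, hmem⟩ := exists_rational_constants_of_circuit_rat _ Q hQ2 hQc'
    refine hN n hn ⟨P, hP2, hPs ▸ hQs, by rwa [map_perPoly] at hPc, ⊥, inferInstance, ?_, hmem⟩
    rw [IntermediateField.finrank_bot, pow_zero]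

end Summit.ValiantsHypothesis.ValiantsHypothesis.Theorems.LangWeilTransfer.ShatteringExclusion

end
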